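import Literature.Analysis.Convolution.DickmanTypeKernel
import Literature.Combinatorics.Enumerative.SetFunctionConvolution
import Literature.Analysis.Convolution.OneSidedConvolutionLipschitz
import HarnessLib

/-!
# `ℓ = log_⋆(δ − ν)`, the Type-I vanishing, and the modified Liouville function `M^{(c,η)}`

Everything PROVED. A one-dimensional model of Ford–Maynard's modified Liouville functions
(K. Ford, J. Maynard, *On the theory of prime producing sieves*, arXiv:2407.14368, §9.1): for a
kernel `ν` supported in `[η, c)` put `ℓ = −∑_{j ≤ J} ν^{⋆j}/j` (`ellFn`) and `M(a) = a ℓ(a)`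
(`modLiouville`, with `ν = B_{η,c} = B_η 𝟙_{[η,c)}`, `truncKernel`). Then

* `sum_cpow_ellFn_eq_zero` — **Type-I vanishing**: `∑_{r=1}^{R} (m^r/r!) ℓ^{⋆r}(w) = 0` for
  `w ≥ m c` in the window (`exp(m log(1−ν)) = (1−ν)^m` at the function level, via `aCoeff_eq` and
  the supports `ν^{⋆n} ⊆ [nη, nc)`); only `supp ν ⊆ [η, c)` is used — this replaces FM Lemma 9.2;
* `sum_cpow_dkKernel_div` — `∑_j B_η^{⋆j}/j = μ_η` on `[0,3]` (`log_⋆ ∘ exp_⋆ = id`, via `bCoeff_eq`);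
* `modLiouville_eq_neg_one` — `M^{(c,η)} = −1` on `[η, c)` (FM (M-tiny));
* `modLiouville_bounds` — **`−1 ≤ M^{(c,η)}(a) ≤ −1 + (a²/η) κ(η,c)`** on `[η, 1]`,
  `κ = η²/(c(c−η)(c−2η))` (FM (M-ineq), with the explicit decay of `DickmanTypeKernel.lean` in
  place of `ρ(c/η − 1)/c`), via Young-type bounds `cpow_sub_cpow_bounds`;
* `exists_lipschitz_modLiouville` — `M^{(c,η)}` is Lipschitz on `[c, 1]`.

Hypotheses throughout: `0 < η ≤ 1`, `3η ≤ c ≤ 1` (window `[0, 3]`).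
-/

noncomputable section

namespace Literature.Analysis.Convolution

open MeasureTheory Set Finset Literature.Combinatorics.Enumerative

/-! ### `ℓ = log_⋆(δ − ν)` and the Type-I vanishing -/

section LogKernel

variable {ν : ℝ → ℝ}

/-- Homogeneity of convolution powers: `(c f)^{⋆n} = c^n f^{⋆n}`. [folklore] -/
theorem cpow_const_mul (c : ℝ) (f : ℝ → ℝ) : ∀ n : ℕ, cpow (fun t => c * f t) n = fun t => c ^ n * cpow f n t
  | 0 => by funext t; simp [cpow_zero]
  | 1 => by funext t; simp [cpow_one]
  | n + 2 => by
    rw [cpow_succ_succ, cpow_succ_succ, cpow_const_mul c f (n + 1), oconv_const_mul_left,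
      oconv_const_mul_right]
    funext t; ring

/-- The truncated logarithm `ℓ_J(ν) = −∑_{j=1}^{J} ν^{⋆j}/j` (`= log_⋆(δ − ν)` on windows where
`ν^{⋆j}`, `j > J`, vanish). [folklore] -/
def ellFn (ν : ℝ → ℝ) (J : ℕ) (t : ℝ) : ℝ := ∑ j ∈ Finset.Icc 1 J, wLog j * cpow ν j t

/-- `ℓ_J(ν)` is locally bounded and measurable. [folklore] -/
theorem locBdd_ellFn (hν : LocBdd ν) (J : ℕ) : LocBdd (ellFn ν J) :=
  LocBdd.sum _ fun j _ => (hν.cpow j).const_mul _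

/-- `ℓ_J(ν) = 0` below `η` if `ν = 0` below `η > 0`... precisely on `(−∞, η)`. [folklore] -/
theorem ellFn_of_lt {η : ℝ} (hη : 0 < η) (hν0 : ∀ t, t < η → ν t = 0) (J : ℕ) {t : ℝ} (ht : t < η) :
    ellFn ν J t = 0 := by
  unfold ellFn
  refine Finset.sum_eq_zero fun j hj => ?_
  have hj1 : 1 ≤ j := (Finset.mem_Icc.1 hj).1
  rw [cpow_eq_zero_of_lt hν0 hj1 (lt_of_lt_of_le ht ?_), mul_zero]
  have : (1 : ℝ) ≤ j := by exact_mod_cast hj1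
  nlinarith

/-- **The Type-I vanishing** (`exp(m log(1 − ν)) = (1 − ν)^m` at the function level): if `ν`
is locally bounded, vanishes on `(−∞, η)` and on `[c, ∞)` (`0 < η`), `J ≤ R` and `A < (J+1)η`,
then for every natural `m` and every `w ∈ [0, A]` with `m c ≤ w`:
`∑_{r=1}^{R} (m^r/r!) ℓ_J(ν)^{⋆r}(w) = 0` (it equals `∑_n (−1)^n (m choose n) ν^{⋆n}(w)`, and
`ν^{⋆n}` vanishes on `[n c, ∞) ∋ w` for `n ≤ m`). [folklore] -/
theorem sum_cpow_ellFn_eq_zero (hν : LocBdd ν) {η c A : ℝ}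
    (hν0 : ∀ t, t < η → ν t = 0) (hc : 0 ≤ c) (hνc : ∀ t, c ≤ t → ν t = 0) {J R : ℕ}
    (hJR : J ≤ R) (hA : A < (J + 1) * η) (m : ℕ) {w : ℝ} (hw : w ∈ Set.Icc 0 A)
    (hmw : m * c ≤ w) :
    ∑ r ∈ Finset.Icc 1 R, (m : ℝ) ^ r / r.factorial * cpow (ellFn ν J) r w = 0 := by
  -- expand each power of `ℓ`
  have hexp : ∀ r ∈ Finset.Icc 1 R, cpow (ellFn ν J) r w =
      ∑ n ∈ Finset.Icc 1 J, compSum wLog r n * cpow ν n w := fun r hr =>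
    cpow_sum_cpow hν hν0 wLog le_rfl hA (Finset.mem_Icc.1 hr).1 w hw
  rw [Finset.sum_congr rfl fun r hr => by rw [hexp r hr]]
  simp_rw [Finset.mul_sum]
  rw [Finset.sum_comm]
  refine Finset.sum_eq_zero fun n hn => ?_
  have hn := Finset.mem_Icc.1 hn
  -- the inner sum over `r` is `aCoeff m n = (−1)^n (m choose n)`
  have hinner : ∑ r ∈ Finset.Icc 1 R, (m : ℝ) ^ r / r.factorial * (compSum wLog r n * cpow ν n w) =
      aCoeff m n * cpow ν n w := by
    rw [aCoeff_eq_sum_range (N := R + 1) (by omega), Finset.sum_mul,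
      Finset.range_eq_Ico, Finset.sum_eq_sum_Ico_succ_bot (by omega),
      compSum_zero_of_ne_zero wLog (by omega)]
    simp only [mul_zero, zero_mul, zero_add]
    rw [show Finset.Icc 1 R = Finset.Ico 1 (R + 1) by rfl]
    exact Finset.sum_congr rfl fun r _ => by ring
  rw [hinner, aCoeff_eq]
  rcases le_or_gt n m with h | h
  · rw [cpow_eq_zero_of_le hνc hn.1 ?_, mul_zero]
    calc (n : ℝ) * c ≤ m * c := mul_le_mul_of_nonneg_right (by exact_mod_cast h) hc
      _ ≤ w := hmw
  · rw [Nat.choose_eq_zero_of_lt h]; simp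

end LogKernel

/-! ### `log_⋆ ∘ exp_⋆ = id` at the function level: `∑_j B_η^{⋆j}/j = μ_η` -/

section Values

variable {η : ℝ}

/-- `dkCoeff k = (−1)^{k+1} wExp k`. [folklore] -/
theorem dkCoeff_eq (k : ℕ) : dkCoeff k = (-1) ^ (k + 1) * wExp k := by
  rw [dkCoeff, wExp]; ring

/-- The coefficient identity behind `log_⋆ ∘ exp_⋆`: `∑_{j=1}^{J} (1/j) E_j^{dkCoeff}(n) = [n = 1]`
for `1 ≤ n ≤ J`. [folklore] -/
theorem sum_inv_mul_compSum_dkCoeff {J n : ℕ} (hn : 1 ≤ n) (hnJ : n ≤ J) :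
    ∑ j ∈ Finset.Icc 1 J, (1 / j : ℝ) * compSum dkCoeff j n = if n = 1 then 1 else 0 := by
  have hfun : (dkCoeff : ℕ → ℝ) = fun k => (-1) ^ (k + 1) * wExp k := funext dkCoeff_eq
  rw [hfun]
  simp_rw [compSum_negOnePow_mul']
  -- restrict the range to `j ≤ n`
  rw [← Finset.sum_subset (Finset.Icc_subset_Icc_right hnJ) fun j hj hjn => by
    simp only [Finset.mem_Icc, not_and, not_le] at hj hjn
    rw [compSum_eq_zero_of_lt wExp (hjn hj.1), mul_zero, mul_zero]]
  have hb := bCoeff_eq hn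
  rw [bCoeff] at hb
  have : ∑ j ∈ Finset.Icc 1 n, (1 / j : ℝ) * ((-1) ^ (n + j) * compSum wExp j n) =
      (-1) ^ (n + 1) * ∑ j ∈ Finset.Icc 1 n, (-1) ^ (j + 1) / j * compSum wExp j n := by
    rw [Finset.mul_sum]
    refine Finset.sum_congr rfl fun j _ => ?_
    have : (-1 : ℝ) ^ (n + j) = (-1) ^ (n + 1) * (-1) ^ (j + 1) := by
      rw [← pow_add, show n + 1 + (j + 1) = n + j + 1 + 1 by ring, pow_succ, pow_succ]
      ring
    rw [this]; ring
  rw [this, hb]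
  split_ifs with h1
  · subst h1; norm_num
  · simp

/-- **`log_⋆(exp_⋆(−μ)) = −μ` at the function level**: `∑_{j=1}^{J} B_η^{⋆j}(a)/j = μ_η(a)` for
`a ∈ [0, 3]`, with `J = dkOrder η`. [folklore] -/
theorem sum_cpow_dkKernel_div (hη : 0 < η) {a : ℝ} (ha : a ∈ Set.Icc 0 3) :
    ∑ j ∈ Finset.Icc 1 (dkOrder η), (1 / j : ℝ) * cpow (dkKernel η) j a = muFn η a := by
  set K := dkOrder η with hK
  have hwin : (3 : ℝ) < (K + 1) * η := by
    have := dkOrder_mul_gt hη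
    rw [← hK] at this
    nlinarith
  have hμ := locBdd_muFn hη
  -- `B^{⋆j} = ∑_n E_j(n) μ^{⋆n}` on `[0, 3]`
  have hexp : ∀ j ∈ Finset.Icc 1 K, cpow (dkKernel η) j a =
      ∑ n ∈ Finset.Icc 1 K, compSum dkCoeff j n * cpow (muFn η) n a := by
    intro j hj
    have := cpow_sum_cpow hμ (fun t ht => muFn_of_lt ht) dkCoeff (le_refl K) hwin
      (Finset.mem_Icc.1 hj).1 a ha
    exact this
  rw [Finset.sum_congr rfl fun j hj => by rw [hexp j hj]]
  simp_rw [Finset.mul_sum]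
  rw [Finset.sum_comm]
  have hone : 1 ≤ K := by rw [hK]; unfold dkOrder; omega
  rw [← Finset.sum_erase_add _ _ (Finset.mem_Icc.2 ⟨le_rfl, hone⟩)]
  have hrest : ∑ n ∈ (Finset.Icc 1 K).erase 1,
      ∑ j ∈ Finset.Icc 1 K, (1 / j : ℝ) * (compSum dkCoeff j n * cpow (muFn η) n a) = 0 := by
    refine Finset.sum_eq_zero fun n hn => ?_
    have hn' := Finset.mem_erase.1 hn
    have hn'' := Finset.mem_Icc.1 hn'.2
    have : ∑ j ∈ Finset.Icc 1 K, (1 / j : ℝ) * (compSum dkCoeff j n * cpow (muFn η) n a) =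
        (∑ j ∈ Finset.Icc 1 K, (1 / j : ℝ) * compSum dkCoeff j n) * cpow (muFn η) n a := by
      rw [Finset.sum_mul]; exact Finset.sum_congr rfl fun j _ => by ring
    rw [this, sum_inv_mul_compSum_dkCoeff hn''.1 hn''.2, if_neg hn'.1, zero_mul]
  rw [hrest, zero_add]
  have : ∑ j ∈ Finset.Icc 1 K, (1 / j : ℝ) * (compSum dkCoeff j 1 * cpow (muFn η) 1 a) =
      (∑ j ∈ Finset.Icc 1 K, (1 / j : ℝ) * compSum dkCoeff j 1) * cpow (muFn η) 1 a := by
    rw [Finset.sum_mul]; exact Finset.sum_congr rfl fun j _ => by ring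
  rw [this, sum_inv_mul_compSum_dkCoeff le_rfl hone, if_pos rfl, one_mul, cpow_one]

/-! ### The modified Liouville function `M^{(c,η)}` -/

/-- The truncated kernel `B_{η,c} = B_η 𝟙_{(−∞, c)}` (`= B_η 𝟙_{[η,c)}`). [folklore] -/
def truncKernel (η c t : ℝ) : ℝ := if t < c then dkKernel η t else 0

/-- `B_{η,c} = B_η` below `c`. [folklore] -/
theorem truncKernel_of_lt {c t : ℝ} (h : t < c) : truncKernel η c t = dkKernel η t := by
  simp [truncKernel, h]

/-- `B_{η,c} = 0` on `[c, ∞)`. [folklore] -/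
theorem truncKernel_of_le {c t : ℝ} (h : c ≤ t) : truncKernel η c t = 0 := by
  simp [truncKernel, not_lt.2 h]

/-- `B_{η,c} = 0` below `η`. [folklore] -/
theorem truncKernel_of_lt_eta (hη : 0 < η) {c t : ℝ} (h : t < η) : truncKernel η c t = 0 := by
  unfold truncKernel; split_ifs
  · exact dkKernel_of_lt hη h
  · rfl

/-- `B_{η,c}` is locally bounded and measurable. [folklore] -/
theorem locBdd_truncKernel (hη : 0 < η) (c : ℝ) : LocBdd (truncKernel η c) := by
  have : truncKernel η c = (Set.Iio c).indicator (dkKernel η) := by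
    funext t; simp [truncKernel, Set.indicator, Set.mem_Iio]
  rw [this]
  exact (locBdd_dkKernel hη).indicator measurableSet_Iio

/-- `B_{η,c} ≥ 0` (`c ≤ 3`). [folklore] -/
theorem truncKernel_nonneg (hη : 0 < η) {c t : ℝ} (hc : c ≤ 3) : 0 ≤ truncKernel η c t := by
  unfold truncKernel; split_ifs with h
  · exact dkKernel_nonneg hη (by linarith)
  · exact le_rfl

/-- `B_{η,c} ≤ B_η` on `(−∞, 3]`. [folklore] -/
theorem truncKernel_le_dkKernel (hη : 0 < η) {c t : ℝ} (ht : t ≤ 3) :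
    truncKernel η c t ≤ dkKernel η t := by
  unfold truncKernel; split_ifs
  · exact le_rfl
  · exact dkKernel_nonneg hη ht

/-- **Ford–Maynard's modified Liouville function** (1-D convolution model):
`M^{(c,η)}(a) = a ℓ(a)` with `ℓ = log_⋆(δ − B_{η,c}) = −∑_j B_{η,c}^{⋆j}/j`
(`J = dkOrder η` terms). Classically `M^{(c,η)}` is Ford–Maynard's (M-def)
[arXiv:2407.14368, §9.1]; here it is CONSTRUCTED from the kernel `B_{η,c}`. [folklore] -/
def modLiouville (η c a : ℝ) : ℝ := a * ellFn (truncKernel η c) (dkOrder η) a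

/-- `M^{(c,η)} = 0` below `η`. [folklore] -/
theorem modLiouville_of_lt (hη : 0 < η) {c a : ℝ} (ha : a < η) : modLiouville η c a = 0 := by
  rw [modLiouville, ellFn_of_lt hη (fun t ht => truncKernel_of_lt_eta hη ht) _ ha, mul_zero]

/-- **`M^{(c,η)} = −1` on `[η, c)`** (`c ≤ 3`): there `ℓ = log_⋆(δ − B_η) = −μ_η`. [folklore] -/
theorem modLiouville_eq_neg_one (hη : 0 < η) {c a : ℝ} (hc : c ≤ 3) (h1 : η ≤ a) (h2 : a < c) :
    modLiouville η c a = -1 := by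
  have ha0 : 0 < a := hη.trans_le h1
  rw [modLiouville, ellFn]
  -- replace `B_{η,c}` by `B_η` on `[0, a]`
  have hagree : ∀ t ∈ Set.Icc 0 a, truncKernel η c t = dkKernel η t := fun t ht =>
    truncKernel_of_lt (lt_of_le_of_lt ht.2 h2)
  have : ∑ j ∈ Finset.Icc 1 (dkOrder η), wLog j * cpow (truncKernel η c) j a =
      -∑ j ∈ Finset.Icc 1 (dkOrder η), (1 / j : ℝ) * cpow (dkKernel η) j a := by
    rw [← Finset.sum_neg_distrib]
    refine Finset.sum_congr rfl fun j _ => ?_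
    rw [cpow_congr_of_eqOn hagree j a ⟨ha0.le, le_rfl⟩, wLog]
    ring
  rw [this, sum_cpow_dkKernel_div hη ⟨ha0.le, by linarith⟩, muFn_of_le h1]
  field_simp


/-! ### The bounds `−1 ≤ M^{(c,η)} ≤ −1 + (a²/η) κ(η,c)` (Ford–Maynard (M-ineq)) -/

/-- The decay constant `κ(η, c) = η² / (c (c − η)(c − 2η))` bounding `B_η` on `[c, 3]`. [folklore] -/
def dkKappa (η c : ℝ) : ℝ := η ^ 2 / (c * (c - η) * (c - 2 * η))

/-- `κ(η,c) ≥ 0` for `3η ≤ c`. [folklore] -/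
theorem dkKappa_nonneg (hη : 0 < η) {c : ℝ} (hc : 3 * η ≤ c) : 0 ≤ dkKappa η c := by
  unfold dkKappa
  have : 0 < c * (c - η) * (c - 2 * η) := by
    apply mul_pos (mul_pos (by linarith) (by linarith)) (by linarith)
  positivity

/-- `B_η ≤ κ(η,c)` on `[c, 3]` (`3η ≤ c`). [folklore] -/
theorem dkKernel_le_dkKappa (hη : 0 < η) {c t : ℝ} (hc : 3 * η ≤ c) (hct : c ≤ t) (ht : t ≤ 3) :
    dkKernel η t ≤ dkKappa η c := by
  refine (dkKernel_le_decay hη (hc.trans hct) ht).trans ?_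
  unfold dkKappa
  have h1 : 0 < c * (c - η) * (c - 2 * η) := mul_pos (mul_pos (by linarith) (by linarith)) (by linarith)
  refine div_le_div_of_nonneg_left (sq_nonneg η) h1 ?_
  have : c - η ≤ t - η := by linarith
  have : c - 2 * η ≤ t - 2 * η := by linarith
  apply mul_le_mul (mul_le_mul hct (by linarith) (by linarith) (by linarith)) (by linarith)
    (by linarith) (mul_nonneg (by linarith) (by linarith))

/-- The kernels cut off at `3` (beyond the window the truncated series is meaningless). [folklore] -/
def dkKernel3 (η t : ℝ) : ℝ := if t ≤ 3 then dkKernel η t else 0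
/-- The truncated kernel cut off at `3`. [folklore] -/
def truncKernel3 (η c t : ℝ) : ℝ := if t ≤ 3 then truncKernel η c t else 0

/-- `B_η 𝟙_{(−∞,3]}` is locally bounded and measurable. [folklore] -/
theorem locBdd_dkKernel3 (hη : 0 < η) : LocBdd (dkKernel3 η) := by
  have : dkKernel3 η = (Set.Iic 3).indicator (dkKernel η) := by
    funext t; simp [dkKernel3, Set.indicator, Set.mem_Iic]
  rw [this]; exact (locBdd_dkKernel hη).indicator measurableSet_Iic

/-- `B_{η,c} 𝟙_{(−∞,3]}` is locally bounded and measurable. [folklore] -/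
theorem locBdd_truncKernel3 (hη : 0 < η) (c : ℝ) : LocBdd (truncKernel3 η c) := by
  have : truncKernel3 η c = (Set.Iic 3).indicator (truncKernel η c) := by
    funext t; simp [truncKernel3, Set.indicator, Set.mem_Iic]
  rw [this]; exact (locBdd_truncKernel hη c).indicator measurableSet_Iic

/-- `B_η 𝟙_{(−∞,3]} ≥ 0` everywhere. [folklore] -/
theorem dkKernel3_nonneg (hη : 0 < η) (t : ℝ) : 0 ≤ dkKernel3 η t := by
  unfold dkKernel3; split_ifs with h
  · exact dkKernel_nonneg hη h
  · exact le_rfl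

/-- `B_{η,c} 𝟙_{(−∞,3]} ≥ 0` everywhere (`c ≤ 3`). [folklore] -/
theorem truncKernel3_nonneg (hη : 0 < η) {c : ℝ} (hc : c ≤ 3) (t : ℝ) : 0 ≤ truncKernel3 η c t := by
  unfold truncKernel3; split_ifs
  · exact truncKernel_nonneg hη hc
  · exact le_rfl

/-- `B_{η,c} 𝟙_{(−∞,3]} ≤ B_η 𝟙_{(−∞,3]}`. [folklore] -/
theorem truncKernel3_le (hη : 0 < η) (c t : ℝ) : truncKernel3 η c t ≤ dkKernel3 η t := by
  unfold truncKernel3 dkKernel3; split_ifs with h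
  · exact truncKernel_le_dkKernel hη h
  · exact le_rfl

/-- `B_η 𝟙_{(−∞,3]} − B_{η,c} 𝟙_{(−∞,3]} ≤ κ(η,c)` everywhere. [folklore] -/
theorem dkKernel3_sub_le (hη : 0 < η) {c : ℝ} (hc : 3 * η ≤ c) (t : ℝ) :
    dkKernel3 η t - truncKernel3 η c t ≤ dkKappa η c := by
  unfold truncKernel3 dkKernel3 truncKernel
  split_ifs with h1 h2
  · simp only [sub_self]; exact dkKappa_nonneg hη hc
  · rw [sub_zero]; exact dkKernel_le_dkKappa hη hc (not_lt.1 h2) h1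
  · simp only [sub_self]; exact dkKappa_nonneg hη hc

/-- `∫_0^a B_η 𝟙_{(−∞,3]} ≤ 1` for `a ≤ 1`. [folklore] -/
theorem setIntegral_dkKernel3_le_one (hη : 0 < η) (hη1 : η ≤ 1) {a : ℝ} (ha : a ≤ 1) :
    ∫ s in Set.Ioc 0 a, dkKernel3 η s ≤ 1 := by
  have : ∫ s in Set.Ioc 0 a, dkKernel3 η s = ∫ s in Set.Ioc 0 a, dkKernel η s :=
    setIntegral_congr_fun measurableSet_Ioc fun s hs => by
      simp [dkKernel3, show s ≤ 3 by linarith [hs.2]]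
  rw [this]
  exact setIntegral_dkKernel_le_one hη (by linarith)

/-- `∫_0^a B_{η,c} 𝟙_{(−∞,3]} ≤ 1` for `a ≤ 1`. [folklore] -/
theorem setIntegral_truncKernel3_le_one (hη : 0 < η) (hη1 : η ≤ 1) {c a : ℝ} (ha : a ≤ 1) :
    ∫ s in Set.Ioc 0 a, truncKernel3 η c s ≤ 1 := by
  refine le_trans (setIntegral_mono_on ((locBdd_truncKernel3 hη c).integrableOn_Ioc 0 a)
    ((locBdd_dkKernel3 hη).integrableOn_Ioc 0 a) measurableSet_Ioc
    fun s _ => truncKernel3_le hη c s) (setIntegral_dkKernel3_le_one hη hη1 ha)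

/-- The differences of powers `D_j = B₃^{⋆j} − B_{c,3}^{⋆j}` satisfy `0 ≤ D_j(a) ≤ j κ` for `a ≤ 1`.
[folklore] -/
theorem cpow_sub_cpow_bounds (hη : 0 < η) (hη1 : η ≤ 1) {c : ℝ} (hc : 3 * η ≤ c) (hc3 : c ≤ 3) :
    ∀ {j : ℕ}, 1 ≤ j → ∀ a, a ≤ 1 →
      0 ≤ cpow (dkKernel3 η) j a - cpow (truncKernel3 η c) j a ∧
        cpow (dkKernel3 η) j a - cpow (truncKernel3 η c) j a ≤ j * dkKappa η c := by
  have hB := locBdd_dkKernel3 hη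
  have hBc := locBdd_truncKernel3 hη c
  have hBc0 := truncKernel3_nonneg hη hc3
  have hB0 := dkKernel3_nonneg hη
  have hle := truncKernel3_le hη c
  have hκ := dkKappa_nonneg hη hc
  intro j hj
  induction j, hj using Nat.le_induction with
  | base =>
    intro a _
    simp only [cpow_one, Nat.cast_one, one_mul]
    exact ⟨sub_nonneg.2 (hle a), dkKernel3_sub_le hη hc a⟩
  | succ j hj ih =>
    intro a ha
    refine ⟨sub_nonneg.2 (cpow_mono hBc hB hBc0 hle _ a), ?_⟩
    rw [cpow_succ _ hj, cpow_succ _ hj]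
    -- `B⋆B^j − Bc⋆Bc^j = (B − Bc)⋆B^j + Bc⋆(B^j − Bc^j)`
    have hsplit : oconv (dkKernel3 η) (cpow (dkKernel3 η) j) a
        - oconv (truncKernel3 η c) (cpow (truncKernel3 η c) j) a =
        oconv (fun t => dkKernel3 η t - truncKernel3 η c t) (cpow (dkKernel3 η) j) a
          + oconv (truncKernel3 η c) (fun t => cpow (dkKernel3 η) j t - cpow (truncKernel3 η c) j t) a := by
      rw [oconv_sub_left hB hBc (hB.cpow j), oconv_sub_right hBc (hB.cpow j) (hBc.cpow j)]
      ring
    rw [hsplit]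
    -- first term `≤ κ ∫ B^j ≤ κ`
    have h1 : oconv (fun t => dkKernel3 η t - truncKernel3 η c t) (cpow (dkKernel3 η) j) a ≤ dkKappa η c := by
      refine (oconv_le_mul_setIntegral (hB.sub hBc) (hB.cpow j) (dkKernel3_sub_le hη hc)
        (cpow_nonneg hB0 j) a).trans ?_
      have hI := setIntegral_cpow_le hB hB0 a hj
      have hI1 := setIntegral_dkKernel3_le_one hη hη1 ha
      have hI0 : 0 ≤ ∫ t in Set.Ioc 0 a, dkKernel3 η t := setIntegral_nonneg measurableSet_Ioc fun t _ => hB0 t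
      calc dkKappa η c * ∫ t in Set.Ioc 0 a, cpow (dkKernel3 η) j t
          ≤ dkKappa η c * (∫ t in Set.Ioc 0 a, dkKernel3 η t) ^ j := mul_le_mul_of_nonneg_left hI hκ
        _ ≤ dkKappa η c * 1 := mul_le_mul_of_nonneg_left (pow_le_one₀ hI0 hI1) hκ
        _ = dkKappa η c := mul_one _
    -- second term `≤ j κ ∫ Bc ≤ j κ` (replace `D_j` by its cut-off at `1`, bounded by `jκ`)
    have h2 : oconv (truncKernel3 η c) (fun t => cpow (dkKernel3 η) j t - cpow (truncKernel3 η c) j t) a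
        ≤ j * dkKappa η c := by
      set D : ℝ → ℝ := fun t => cpow (dkKernel3 η) j t - cpow (truncKernel3 η c) j t with hD
      set D' : ℝ → ℝ := (Set.Iic 1).indicator D with hD'
      have hDl : LocBdd D := (hB.cpow j).sub (hBc.cpow j)
      have hD'l : LocBdd D' := hDl.indicator measurableSet_Iic
      have hD'le : ∀ t, D' t ≤ j * dkKappa η c := by
        intro t
        simp only [hD', Set.indicator, Set.mem_Iic]
        split_ifs with ht
        · exact (ih t ht).2
        · positivity
      rw [oconv_congr_of_eqOn (fun t _ => rfl) (fun t ht => ?_) ha, oconv_comm]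
      · refine (oconv_le_mul_setIntegral hD'l hBc hD'le hBc0 a).trans ?_
        calc (j : ℝ) * dkKappa η c * ∫ t in Set.Ioc 0 a, truncKernel3 η c t
            ≤ j * dkKappa η c * 1 :=
              mul_le_mul_of_nonneg_left (setIntegral_truncKernel3_le_one hη hη1 ha) (by positivity)
          _ = j * dkKappa η c := mul_one _
      · simp only [hD', Set.indicator, Set.mem_Iic]
        rw [if_pos ht.2]
    push_cast
    linarith


/-- **Ford–Maynard's (M-ineq), 1-D model**: for `0 < η ≤ 1`, `3η ≤ c ≤ 1` and `a ∈ [η, 1]`,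
`−1 ≤ M^{(c,η)}(a) ≤ −1 + (a²/η) κ(η, c)`. [folklore] -/
theorem modLiouville_bounds (hη : 0 < η) (hη1 : η ≤ 1) {c : ℝ} (hc : 3 * η ≤ c) (hc1 : c ≤ 1)
    {a : ℝ} (h1 : η ≤ a) (h2 : a ≤ 1) :
    -1 ≤ modLiouville η c a ∧ modLiouville η c a ≤ -1 + a ^ 2 / η * dkKappa η c := by
  have ha0 : 0 < a := hη.trans_le h1
  set K := dkOrder η with hK
  -- `M(a) + 1 = a ∑_j (1/j) D_j(a)`
  have hB3 : ∀ t ∈ Set.Icc 0 a, dkKernel η t = dkKernel3 η t := fun t ht => by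
    simp [dkKernel3, show t ≤ 3 by linarith [ht.2]]
  have hBc3 : ∀ t ∈ Set.Icc 0 a, truncKernel η c t = truncKernel3 η c t := fun t ht => by
    simp [truncKernel3, show t ≤ 3 by linarith [ht.2]]
  have hM : modLiouville η c a + 1 = a * ∑ j ∈ Finset.Icc 1 K,
      (1 / j : ℝ) * (cpow (dkKernel3 η) j a - cpow (truncKernel3 η c) j a) := by
    have hone : a * ∑ j ∈ Finset.Icc 1 K, (1 / j : ℝ) * cpow (dkKernel η) j a = 1 := by
      rw [sum_cpow_dkKernel_div hη ⟨ha0.le, by linarith⟩, muFn_of_le h1]; field_simp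
    have step : modLiouville η c a + 1 =
        modLiouville η c a + a * ∑ j ∈ Finset.Icc 1 K, (1 / j : ℝ) * cpow (dkKernel η) j a := by
      rw [hone]
    rw [step, modLiouville, ellFn, ← hK, ← mul_add, ← Finset.sum_add_distrib]
    congr 1
    refine Finset.sum_congr rfl fun j _ => ?_
    rw [cpow_congr_of_eqOn hBc3 j a ⟨ha0.le, le_rfl⟩, cpow_congr_of_eqOn hB3 j a ⟨ha0.le, le_rfl⟩, wLog]
    ring
  -- termwise bounds
  have hκ := dkKappa_nonneg hη hc
  have hterm : ∀ j ∈ Finset.Icc 1 K,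
      0 ≤ (1 / j : ℝ) * (cpow (dkKernel3 η) j a - cpow (truncKernel3 η c) j a) ∧
      (1 / j : ℝ) * (cpow (dkKernel3 η) j a - cpow (truncKernel3 η c) j a) ≤
        if (j : ℝ) * η ≤ a then dkKappa η c else 0 := by
    intro j hj
    have hj1 : 1 ≤ j := (Finset.mem_Icc.1 hj).1
    have hjpos : (0 : ℝ) < j := by exact_mod_cast hj1
    obtain ⟨hD0, hD1⟩ := cpow_sub_cpow_bounds hη hη1 hc (by linarith) hj1 a h2
    refine ⟨by positivity, ?_⟩
    split_ifs with hja
    · rw [div_mul_eq_mul_div, one_mul, div_le_iff₀ hjpos]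
      linarith
    · -- both powers vanish at `a < j η`
      have hlt : a < j * η := not_le.1 hja
      rw [cpow_eq_zero_of_lt (fun t ht => by simp [dkKernel3, dkKernel_of_lt hη ht, show t ≤ 3 by linarith]) hj1 hlt,
        cpow_eq_zero_of_lt (fun t ht => by simp [truncKernel3, truncKernel_of_lt_eta hη ht, show t ≤ 3 by linarith]) hj1 hlt]
      simp
  have hsum0 : 0 ≤ ∑ j ∈ Finset.Icc 1 K, (1 / j : ℝ) * (cpow (dkKernel3 η) j a - cpow (truncKernel3 η c) j a) :=
    Finset.sum_nonneg fun j hj => (hterm j hj).1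
  have hsum1 : ∑ j ∈ Finset.Icc 1 K, (1 / j : ℝ) * (cpow (dkKernel3 η) j a - cpow (truncKernel3 η c) j a)
      ≤ a / η * dkKappa η c := by
    refine (Finset.sum_le_sum fun j hj => (hterm j hj).2).trans ?_
    rw [Finset.sum_ite, Finset.sum_const_zero, add_zero, Finset.sum_const, nsmul_eq_mul]
    refine mul_le_mul_of_nonneg_right ?_ hκ
    have hsub : (Finset.Icc 1 K).filter (fun j : ℕ => (j : ℝ) * η ≤ a) ⊆ Finset.Icc 1 ⌊a / η⌋₊ := by
      intro j hj
      simp only [Finset.mem_filter, Finset.mem_Icc] at hj ⊢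
      refine ⟨hj.1.1, Nat.le_floor ?_⟩
      rw [le_div_iff₀ hη]; exact hj.2
    calc (((Finset.Icc 1 K).filter (fun j : ℕ => (j : ℝ) * η ≤ a)).card : ℝ)
        ≤ (Finset.Icc 1 ⌊a / η⌋₊).card := by exact_mod_cast Finset.card_le_card hsub
      _ = ⌊a / η⌋₊ := by simp
      _ ≤ a / η := Nat.floor_le (by positivity)
  constructor
  · linarith [mul_nonneg ha0.le hsum0]
  · have := mul_le_mul_of_nonneg_left hsum1 ha0.le
    calc modLiouville η c a = -1 + a * ∑ j ∈ Finset.Icc 1 K,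
          (1 / j : ℝ) * (cpow (dkKernel3 η) j a - cpow (truncKernel3 η c) j a) := by linarith
      _ ≤ -1 + a * (a / η * dkKappa η c) := by linarith
      _ = -1 + a ^ 2 / η * dkKappa η c := by ring


/-! ### Lipschitz continuity of `M^{(c,η)}` on `[c, 1]` -/

/-- "Lipschitz on `S` with some constant" is preserved under finite sums. [folklore] -/
theorem exists_lipschitz_sum {ι : Type*} (s : Finset ι) {F : ι → ℝ → ℝ} {S : Set ℝ}
    (h : ∀ i ∈ s, ∃ L : ℝ, 0 ≤ L ∧ ∀ a ∈ S, ∀ b ∈ S, |F i a - F i b| ≤ L * |a - b|) :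
    ∃ L : ℝ, 0 ≤ L ∧ ∀ a ∈ S, ∀ b ∈ S, |∑ i ∈ s, F i a - ∑ i ∈ s, F i b| ≤ L * |a - b| := by
  classical
  induction s using Finset.induction_on with
  | empty => exact ⟨0, le_rfl, fun a _ b _ => by simp⟩
  | insert i s hi ih =>
    obtain ⟨L₁, hL₁, h₁⟩ := h i (Finset.mem_insert_self i s)
    obtain ⟨L₂, hL₂, h₂⟩ := ih fun j hj => h j (Finset.mem_insert_of_mem hj)
    refine ⟨L₁ + L₂, by positivity, fun a ha b hb => ?_⟩
    rw [Finset.sum_insert hi, Finset.sum_insert hi]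
    calc |F i a + ∑ j ∈ s, F j a - (F i b + ∑ j ∈ s, F j b)|
        = |(F i a - F i b) + (∑ j ∈ s, F j a - ∑ j ∈ s, F j b)| := by ring_nf
      _ ≤ |F i a - F i b| + |∑ j ∈ s, F j a - ∑ j ∈ s, F j b| := abs_add_le _ _
      _ ≤ L₁ * |a - b| + L₂ * |a - b| := add_le_add (h₁ a ha b hb) (h₂ a ha b hb)
      _ = (L₁ + L₂) * |a - b| := by ring

/-- The truncated kernel `B_{η,c}` (`3η ≤ c ≤ 3`): bounded by `1/η`, zero off `[η, c)`, and
`2/η²`-Lipschitz on `[η, c)`. [folklore] -/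
theorem truncKernel_props (hη : 0 < η) {c : ℝ} (hc3 : c ≤ 3) :
    (∀ t, |truncKernel η c t| ≤ 1 / η) ∧ (∀ t, t < η → truncKernel η c t = 0) ∧
    (∀ t, c ≤ t → truncKernel η c t = 0) ∧
    (∀ s t, s ∈ Set.Ico η c → t ∈ Set.Ico η c →
      |truncKernel η c s - truncKernel η c t| ≤ 2 / η ^ 2 * |s - t|) := by
  refine ⟨fun t => ?_, fun t ht => truncKernel_of_lt_eta hη ht, fun t ht => truncKernel_of_le ht,
    fun s t hs ht => ?_⟩
  · unfold truncKernel
    split_ifs with h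
    · rw [abs_of_nonneg (dkKernel_nonneg hη (by linarith))]
      exact dkKernel_le hη (by linarith)
    · rw [abs_zero]; positivity
  · rw [truncKernel_of_lt hs.2, truncKernel_of_lt ht.2]
    exact abs_dkKernel_sub_le hη ⟨hs.1, by linarith [hs.2]⟩ ⟨ht.1, by linarith [ht.2]⟩

/-- The convolution powers `B_{η,c}^{⋆(j+1)}`, `j ≥ 1`, are Lipschitz on `[0, 1]`. [folklore] -/
theorem exists_lipschitz_cpow_truncKernel (hη : 0 < η) {c : ℝ} (hc3 : c ≤ 3)
    (j : ℕ) : ∃ L : ℝ, 0 ≤ L ∧ ∀ a ∈ Set.Icc (0:ℝ) 1, ∀ b ∈ Set.Icc (0:ℝ) 1,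
      |cpow (truncKernel η c) (j + 2) a - cpow (truncKernel η c) (j + 2) b| ≤ L * |a - b| := by
  obtain ⟨hbd, h0, hcz, hLip⟩ := truncKernel_props hη hc3
  have hν := locBdd_truncKernel hη c
  obtain ⟨Cg, hCg⟩ := (hν.cpow (j + 1)).bdd 1
  set L : ℝ := Cg * (2 / η ^ 2 * 1 + 2 * (1 / η)) + 1 / η * Cg with hLdef
  have hCg0 : 0 ≤ Cg := (abs_nonneg _).trans (hCg 0 (by simp))
  refine ⟨L, by positivity, fun a ha b hb => ?_⟩
  rw [cpow_succ_succ]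
  wlog hab : b ≤ a generalizing a b
  · rw [abs_sub_comm, abs_sub_comm a]
    exact this b hb a ha (not_le.1 hab).le
  have key := abs_oconv_sub_oconv_le hν (hν.cpow (j + 1)) (by positivity) h0 hcz hbd hLip
    (X := 1) hCg hb.1 hab ha.2
  rw [abs_of_nonneg (by linarith : 0 ≤ a - b)]
  convert key using 1

/-- **`M^{(c,η)}` is Lipschitz on `[c, 1]`** (`0 < η`, `3η ≤ c ≤ 1`). [folklore] -/
theorem exists_lipschitz_modLiouville (hη : 0 < η) {c : ℝ} (hc : 3 * η ≤ c) (hc1 : c ≤ 1) :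
    ∃ L : ℝ, 0 ≤ L ∧ ∀ a ∈ Set.Icc c 1, ∀ b ∈ Set.Icc c 1,
      |modLiouville η c a - modLiouville η c b| ≤ L * |a - b| := by
  have hc3 : c ≤ 3 := by linarith
  have hν := locBdd_truncKernel hη c
  -- `ℓ` is Lipschitz on `[c, 1]`
  have hell : ∃ Λ : ℝ, 0 ≤ Λ ∧ ∀ a ∈ Set.Icc c 1, ∀ b ∈ Set.Icc c 1,
      |ellFn (truncKernel η c) (dkOrder η) a - ellFn (truncKernel η c) (dkOrder η) b| ≤ Λ * |a - b| := by
    unfold ellFn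
    refine exists_lipschitz_sum _ fun j hj => ?_
    have hj1 : 1 ≤ j := (Finset.mem_Icc.1 hj).1
    rcases Nat.lt_or_ge j 2 with hj2 | hj2
    · -- `j = 1`: the term `-ν` vanishes on `[c, 1]`
      have : j = 1 := by omega
      subst this
      refine ⟨0, le_rfl, fun a ha b hb => ?_⟩
      rw [cpow_one, truncKernel_of_le ha.1, truncKernel_of_le hb.1]; simp
    · obtain ⟨k, rfl⟩ : ∃ k, j = k + 2 := ⟨j - 2, by omega⟩
      obtain ⟨L, hL, hLk⟩ := exists_lipschitz_cpow_truncKernel hη hc3 k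
      refine ⟨|wLog (k + 2)| * L, by positivity, fun a ha b hb => ?_⟩
      have hc0 : 0 ≤ c := by linarith
      rw [← mul_sub, abs_mul, mul_assoc]
      exact mul_le_mul_of_nonneg_left (hLk a ⟨hc0.trans ha.1, ha.2⟩ b ⟨hc0.trans hb.1, hb.2⟩) (abs_nonneg _)
  obtain ⟨Λ, hΛ, hΛab⟩ := hell
  obtain ⟨Cl, hCl⟩ := (locBdd_ellFn hν (dkOrder η)).bdd 1
  have hCl0 : 0 ≤ Cl := (abs_nonneg _).trans (hCl 0 (by simp))
  refine ⟨Λ + Cl, by positivity, fun a ha b hb => ?_⟩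
  have hc0 : 0 ≤ c := by linarith
  unfold modLiouville
  have hlb : |ellFn (truncKernel η c) (dkOrder η) b| ≤ Cl :=
    hCl b (by rw [abs_of_nonneg (hc0.trans hb.1)]; exact hb.2)
  calc |a * ellFn (truncKernel η c) (dkOrder η) a - b * ellFn (truncKernel η c) (dkOrder η) b|
      = |a * (ellFn (truncKernel η c) (dkOrder η) a - ellFn (truncKernel η c) (dkOrder η) b)
          + (a - b) * ellFn (truncKernel η c) (dkOrder η) b| := by ring_nf
    _ ≤ |a| * |ellFn (truncKernel η c) (dkOrder η) a - ellFn (truncKernel η c) (dkOrder η) b|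
          + |a - b| * |ellFn (truncKernel η c) (dkOrder η) b| := by
        rw [← abs_mul, ← abs_mul]; exact abs_add_le _ _
    _ ≤ 1 * (Λ * |a - b|) + |a - b| * Cl := by
        refine add_le_add (mul_le_mul ?_ (hΛab a ha b hb) (abs_nonneg _) zero_le_one)
          (mul_le_mul_of_nonneg_left hlb (abs_nonneg _))
        rw [abs_of_nonneg (hc0.trans ha.1)]; exact ha.2
    _ = (Λ + Cl) * |a - b| := by ring

end Values

end Literature.Analysis.Convolution
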